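import Summits.CriticalPhenomena.SAWScalingLimit.Theorems.SAWReversalUpgradeAttachNoReturnPieces
import Summits.CriticalPhenomena.SAWScalingLimit.Theorems.SAWReversalUpgradeAttachNoReturnArc
import HarnessLib

/-!
# Route `SAWReversalUpgrade`, support `AttachNoReturn` (stmt-CriticalPhenomena-18057):
# the fallback attachment `{a, b} ∪ Φ(iℝ₊)` has no deep return and no escape

Helper file for the proof of
`Summit.CriticalPhenomena.SAWScalingLimit.Theses.SAWReversalUpgrade.AttachNoReturn`.

In the degenerate case of the route's attachment `let`-block the attached curve `c` is an
injective curve from `a` to `b` with the FIXED trace `AttachReversal.fallback a b Φ =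
{a, b} ∪ Φ (i · (0, ∞))` (the hyperbolic geodesic of `(D; a, b)`). Along it the order of
traversal is that of `y ↦ Φ (i y)` (`fallback_lt_of_lt`, from `AttachNoReturn.arc_order`), so:

* `fallback_no_return` — for every `ε > 0` there is `r > 0`, depending only on `(D, φ, ε)`, such
  that NO such curve is `ε`-far from `a` at some time and `r`-close to `a` at a later time;
* `fallback_no_escape` — the same for "`r`-close to `b`, later `ε`-far from `b`".
-/

noncomputable section

open Set Filter Metric Complex Function
open scoped Topology unitInterval
open UpperHalfPlane (upperHalfPlaneSet)
open Literature.Probability.RandomPlanarGeometry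

namespace Summit.CriticalPhenomena.SAWScalingLimit.Theorems

namespace AttachNoReturn

open AttachReversal FaithfulAttach

variable {D : DobrushinDomain} {φ : ConformalEquiv upperHalfPlaneSet D.carrier}

section Fallback

variable (hφ : D.IsChordalUniformizing φ)
include hφ

/-- The geodesic parametrisation `g y = Φ (i y)`: continuous on `[0, ∞)`, `g 0 = a`, never `b`,
equal to `a` only at `0`, injective on `[0, ∞)`, and tending to `b` at infinity. -/
theorem geodesic_spec {g : ℝ → ℂ} (hg : ∀ y, g y = φ.boundaryExtension (Complex.I * (y : ℂ))) :
    ContinuousOn g (Ici 0) ∧ g 0 = D.pt 0 ∧ (∀ y : ℝ, 0 ≤ y → g y ≠ D.pt 1) ∧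
      (∀ y : ℝ, 0 < y → g y ≠ D.pt 0) ∧ (∀ y y' : ℝ, 0 ≤ y → 0 ≤ y' → g y = g y' → y = y') ∧
      Tendsto g atTop (𝓝 (D.pt 1)) := by
  have hI : 0 ≤ Complex.I.im := by simp
  have him : ∀ y : ℝ, 0 ≤ y → 0 ≤ (Complex.I * (y : ℂ)).im := fun y hy => by
    rw [mul_comm]; exact ray_im_nonneg hI hy
  have hfun : g = fun y : ℝ => φ.boundaryExtension ((y : ℂ) * Complex.I) := by
    funext y; rw [hg, mul_comm]
  refine ⟨?_, ?_, fun y hy => ?_, fun y hy h => ?_, fun y y' hy hy' h => ?_, ?_⟩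
  · rw [hfun]; exact ray_continuousOn (continuousOn_boundaryExtension_im_nonneg φ) hI
  · rw [hg, Complex.ofReal_zero, mul_zero, hφ.boundaryExtension_zero]
  · rw [hg]; exact bext_ne_pt_one hφ (him y hy)
  · rw [hg, bext_eq_pt_zero_iff hφ (him y hy.le), mul_eq_zero] at h
    rcases h with h | h
    · exact Complex.I_ne_zero h
    · exact hy.ne' (by exact_mod_cast h)
  · rw [hg, hg] at h
    have h1 := bext_injOn φ (him y hy) (him y' hy') h
    exact_mod_cast mul_left_cancel₀ Complex.I_ne_zero h1
  · rw [hfun]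
    exact ray_tendsto_pt hφ.tendsto_boundaryExtension_cocompact hI Complex.I_ne_zero

/-- The fallback trace written with `g`. -/
theorem fallback_eq {g : ℝ → ℂ} (hg : ∀ y, g y = φ.boundaryExtension (Complex.I * (y : ℂ))) :
    fallback (D.pt 0) (D.pt 1) φ.boundaryExtension = {D.pt 0, D.pt 1} ∪ g '' Ioi 0 := by
  have _ := hφ
  rw [fallback, show (fun y : ℝ => φ.boundaryExtension (Complex.I * (y : ℂ))) = g from
    funext fun y => (hg y).symm]

/-- **Order along the fallback arc**: two values `Φ (i yₛ)`, `Φ (i yₜ)` met by the curve in this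
order (`s < t`) satisfy `yₛ < yₜ`. Instance of `arc_order` with head `{a}`, middle piece
`y ↦ Φ (i y)` on `[0, Y]` and tail `Φ (i [Y, ∞)) ∪ {b}`. -/
theorem fallback_lt_of_lt {g : ℝ → ℂ} (hg : ∀ y, g y = φ.boundaryExtension (Complex.I * (y : ℂ)))
    {c : Curve ℂ} (hcinj : Injective c) (hc0 : c 0 = D.pt 0)
    (hc1 : c 1 = D.pt 1) (hcrange : range c = fallback (D.pt 0) (D.pt 1) φ.boundaryExtension)
    {Y : ℝ} (hY : 0 < Y) {s t : I} (hst : s < t) {ys yt : ℝ} (hys : ys ∈ Icc 0 Y)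
    (hyt : yt ∈ Icc 0 Y) (hcs : c s = g ys) (hct : c t = g yt) : ys < yt := by
  obtain ⟨hgc, hg0, hgb, hga, hginj, hglim⟩ := geodesic_spec hφ hg
  rw [fallback_eq hφ hg] at hcrange
  set a := D.pt 0 with ha
  set b := D.pt 1 with hb
  have hab : a ≠ b := D.pt_injective.ne (by decide)
  set Tail : Set ℂ := g '' Ici Y ∪ {b} with hTail
  have hrange : range c = {a} ∪ g '' Icc 0 Y ∪ Tail := by
    rw [hcrange, hTail]
    ext x
    simp only [mem_union, mem_insert_iff, mem_singleton_iff, mem_image, mem_Ioi, mem_Icc, mem_Ici]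
    constructor
    · rintro ((rfl | rfl) | ⟨y, hy, rfl⟩)
      · exact Or.inl (Or.inl rfl)
      · exact Or.inr (Or.inr rfl)
      · rcases le_or_gt y Y with h | h
        · exact Or.inl (Or.inr ⟨y, ⟨hy.le, h⟩, rfl⟩)
        · exact Or.inr (Or.inl ⟨y, h.le, rfl⟩)
    · rintro ((rfl | ⟨y, ⟨hy0, -⟩, rfl⟩) | ⟨y, hy, rfl⟩ | rfl)
      · exact Or.inl (Or.inl rfl)
      · rcases hy0.eq_or_lt with rfl | hpos
        · exact Or.inl (Or.inl hg0)
        · exact Or.inr ⟨y, hpos, rfl⟩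
      · exact Or.inr ⟨y, hY.trans_le hy, rfl⟩
      · exact Or.inl (Or.inr rfl)
  have hZc : ContinuousOn g (Icc 0 Y) := hgc.mono Icc_subset_Ici_self
  have hflat : ∀ u ∈ Icc (0 : ℝ) Y, ∀ u' ∈ Icc (0 : ℝ) Y, u ≤ u' → g u = g u' →
      ∀ w ∈ Icc u u', g w = g u := by
    intro u hu u' hu' _ heq w hw
    have := hginj u u' hu.1 hu'.1 heq
    subst this
    rw [le_antisymm hw.2 hw.1]
  have hbT : b ∈ Tail := Or.inr rfl
  have hJbT : g Y ∈ Tail := Or.inl ⟨Y, self_mem_Ici, rfl⟩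
  have hJaT : a ∉ Tail := by
    rintro (⟨y, hy, hya⟩ | hab')
    · exact hga y (hY.trans_le hy) hya
    · exact hab hab'
  have hJbH : g Y ∉ ({a} : Set ℂ) := fun h => hga Y hY h
  -- the tail and its punctured version are preconnected (ray + limit point)
  have hpre : ∀ S : Set ℝ, IsPreconnected S → S ⊆ Ici Y → (∀ᶠ y in atTop, y ∈ S) →
      IsPreconnected (g '' S ∪ {b}) := by
    intro S hS hSY hev
    have hEc : IsPreconnected (g '' S) := hS.image _ (hgc.mono (hSY.trans fun y hy => hY.le.trans hy))
    have hbcl : b ∈ closure (g '' S) :=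
      mem_closure_of_tendsto hglim (hev.mono fun y hy => ⟨y, hy, rfl⟩)
    refine hEc.subset_closure subset_union_left ?_
    rintro x (hx | hx)
    · exact subset_closure hx
    · rw [mem_singleton_iff] at hx; rw [hx]; exact hbcl
  have hTc : IsPreconnected Tail := hpre _ isPreconnected_Ici Subset.rfl (eventually_ge_atTop Y)
  have hT' : (b ∈ Tail \ {g Y} ∧ IsPreconnected (Tail \ {g Y})) ∨ Tail ⊆ {b} := by
    left
    have hbne : b ≠ g Y := fun h => hgb Y hY.le h.symm
    have hTJ : Tail \ {g Y} = g '' Ioi Y ∪ {b} := by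
      rw [hTail]
      ext x
      simp only [Set.mem_sdiff, mem_union, mem_image, mem_Ici, mem_Ioi, mem_singleton_iff]
      constructor
      · rintro ⟨⟨y, hy, rfl⟩ | rfl, hne⟩
        · exact Or.inl ⟨y, lt_of_le_of_ne hy fun h => hne (by rw [h]), rfl⟩
        · exact Or.inr rfl
      · rintro (⟨y, hy, rfl⟩ | rfl)
        · exact ⟨Or.inl ⟨y, hy.le, rfl⟩, fun h => hy.ne' (hginj y Y (hY.le.trans hy.le) hY.le h)⟩
        · exact ⟨hbT, hbne⟩
    refine ⟨⟨hbT, hbne⟩, ?_⟩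
    rw [hTJ]
    exact hpre _ isPreconnected_Ioi (fun y hy => le_of_lt (mem_Ioi.1 hy)) (eventually_gt_atTop Y)
  obtain ⟨ta, tb, -, -, -, -, -, -, -, hA8⟩ :=
    arc_order (X := ℂ) (att := ⇑c) (Head := {a}) c.continuous hcinj hc0 hc1 hrange hZc hY.le hg0 rfl
      hflat (mem_singleton _) hbT hJbT hJaT hJbH isPreconnected_singleton hTc (Or.inr Subset.rfl) hT'
  obtain ⟨x, hx, y, hy, hxy, hgx, hgy⟩ := hA8 s t hst ⟨ys, hys, hcs.symm⟩ ⟨yt, hyt, hct.symm⟩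
  have h1 : x = ys := hginj x ys hx.1 hys.1 (hgx.trans hcs)
  have h2 : y = yt := hginj y yt hy.1 hyt.1 (hgy.trans hct)
  rw [← h1, ← h2]
  exact hxy

/-- Values of a fallback curve: `a` (only at time `0`), `b` (only at time `1`), or `Φ (i y)`
with `y > 0`. -/
theorem fallback_value {g : ℝ → ℂ} (hg : ∀ y, g y = φ.boundaryExtension (Complex.I * (y : ℂ)))
    {c : Curve ℂ} (hcinj : Injective c) (hc0 : c 0 = D.pt 0)
    (hc1 : c 1 = D.pt 1) (hcrange : range c = fallback (D.pt 0) (D.pt 1) φ.boundaryExtension)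
    (t : I) : (c t = D.pt 0 ∧ t = 0) ∨ (c t = D.pt 1 ∧ t = 1) ∨ ∃ y : ℝ, 0 < y ∧ c t = g y := by
  have ht : c t ∈ range c := mem_range_self t
  rw [hcrange, fallback_eq hφ hg] at ht
  simp only [mem_union, mem_insert_iff, mem_singleton_iff, mem_image, mem_Ioi] at ht
  rcases ht with (h | h) | ⟨y, hy, h⟩
  · exact Or.inl ⟨h, hcinj (h.trans hc0.symm)⟩
  · exact Or.inr (Or.inl ⟨h, hcinj (h.trans hc1.symm)⟩)
  · exact Or.inr (Or.inr ⟨y, hy, h.symm⟩)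

/-- **No deep return along the fallback arc.** For every `ε > 0` there is `r > 0` (depending on
`(D, φ, ε)` only) such that no injective curve from `a` to `b` with trace `fallback a b Φ` is
`ε`-far from `a` at a time `s` and `r`-close to `a` at a later time `t`. -/
theorem fallback_no_return {ε : ℝ} (hε : 0 < ε) :
    ∃ r > 0, ∀ (c : Curve ℂ), Injective c → c 0 = D.pt 0 → c 1 = D.pt 1 →
      range c = fallback (D.pt 0) (D.pt 1) φ.boundaryExtension →
      ∀ s t : I, s < t → ε ≤ dist (c s) (D.pt 0) → dist (c t) (D.pt 0) ≤ r → False := by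
  set g : ℝ → ℂ := fun y : ℝ => φ.boundaryExtension (Complex.I * (y : ℂ)) with hgdef
  have hg : ∀ y, g y = φ.boundaryExtension (Complex.I * (y : ℂ)) := fun y => rfl
  obtain ⟨hgc, hg0, hgb, hga, hginj, hglim⟩ := geodesic_spec hφ hg
  have hdc : ∀ p : ℂ, ContinuousOn (fun y => dist (g y) p) (Ici 0) := fun p =>
    continuous_dist.comp_continuousOn (hgc.prodMk continuousOn_const)
  have hd : 0 < dist (D.pt 0) (D.pt 1) := dist_pos.2 (D.pt_injective.ne (by decide))
  set K : Set ℝ := {y | 0 ≤ y ∧ ε ≤ dist (g y) (D.pt 0)} with hK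
  by_cases hKne : K.Nonempty
  · -- the first far parameter `y*`, and the near radius below it
    have hKcl : IsClosed K := by
      have : K = Ici 0 ∩ (fun y => dist (g y) (D.pt 0)) ⁻¹' Ici ε := by
        ext y; simp [hK, mem_Ici]
      rw [this]
      exact (hdc _).preimage_isClosed_of_isClosed isClosed_Ici isClosed_Ici
    have hKbdd : BddBelow K := ⟨0, fun y hy => hy.1⟩
    set ystar := sInf K with hystar
    have hymem : ystar ∈ K := hKcl.csInf_mem hKne hKbdd
    have hy0 : 0 < ystar := by
      rcases hymem.1.eq_or_lt with h | h
      · exfalso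
        have := hymem.2
        rw [← h, hg0, dist_self] at this
        linarith
      · exact h
    have hbelow : ∀ y, 0 ≤ y → y < ystar → dist (g y) (D.pt 0) < ε := by
      intro y hy hlt
      by_contra h
      rw [not_lt] at h
      have : ystar ≤ y := csInf_le hKbdd ⟨hy, h⟩
      linarith
    -- beyond `y*` the geodesic stays at distance `≥ m > 0` from `a`
    obtain ⟨Y₀, hY₀⟩ : ∃ Y₀, ∀ y, Y₀ ≤ y → dist (D.pt 0) (D.pt 1) / 2 < dist (g y) (D.pt 0) := by
      have hev : ∀ᶠ y in atTop, dist (g y) (D.pt 1) < dist (D.pt 0) (D.pt 1) / 2 :=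
        Metric.tendsto_nhds.1 hglim _ (half_pos hd)
      obtain ⟨Y₀, hY₀⟩ := Filter.eventually_atTop.1 hev
      refine ⟨Y₀, fun y hy => ?_⟩
      have := dist_triangle (D.pt 0) (g y) (D.pt 1)
      rw [dist_comm (D.pt 0) (g y)] at this
      linarith [hY₀ y hy]
    obtain ⟨m, hm, hfar⟩ : ∃ m > 0, ∀ y, ystar ≤ y → m ≤ dist (g y) (D.pt 0) := by
      have hcpt : IsCompact (Icc ystar (max ystar Y₀)) := isCompact_Icc
      have hcont : ContinuousOn (fun y => dist (g y) (D.pt 0)) (Icc ystar (max ystar Y₀)) :=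
        (hdc _).mono fun y hy => hy0.le.trans hy.1
      obtain ⟨y₀, hy₀, hmin⟩ := hcpt.exists_isMinOn (nonempty_Icc.2 (le_max_left _ _)) hcont
      have hpos : 0 < dist (g y₀) (D.pt 0) := dist_pos.2 (hga y₀ (hy0.trans_le hy₀.1))
      refine ⟨min (dist (g y₀) (D.pt 0)) (dist (D.pt 0) (D.pt 1) / 2), lt_min hpos (half_pos hd),
        fun y hy => ?_⟩
      rcases le_or_gt y (max ystar Y₀) with h | h
      · exact (min_le_left _ _).trans (hmin ⟨hy, h⟩)
      · exact (min_le_right _ _).trans (hY₀ y ((le_max_right _ _).trans h.le)).le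
    refine ⟨min m (dist (D.pt 0) (D.pt 1)) / 2, by positivity, ?_⟩
    intro c hcinj hc0 hc1 hcrange s t hst hfs hnt
    have hr_lt_m : min m (dist (D.pt 0) (D.pt 1)) / 2 < m := by
      have := min_le_left m (dist (D.pt 0) (D.pt 1)); linarith
    have hr_lt_d : min m (dist (D.pt 0) (D.pt 1)) / 2 < dist (D.pt 0) (D.pt 1) := by
      have := min_le_right m (dist (D.pt 0) (D.pt 1)); linarith
    -- the near point is `g yt` with `yt < y*`, the far point is `g ys` with `y* ≤ ys`
    rcases fallback_value hφ hg hcinj hc0 hc1 hcrange t with ⟨-, ht0⟩ | ⟨hctb, -⟩ | ⟨yt, hyt, hct⟩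
    · rw [ht0] at hst
      exact (not_lt.2 (show (0 : I) ≤ s from Subtype.coe_le_coe.1 s.2.1)) hst
    · rw [hctb, dist_comm] at hnt
      linarith
    rcases fallback_value hφ hg hcinj hc0 hc1 hcrange s with ⟨hcsa, -⟩ | ⟨-, hs1⟩ | ⟨ys, hys, hcs⟩
    · rw [hcsa, dist_self] at hfs
      linarith
    · rw [hs1] at hst
      exact (not_lt.2 (show t ≤ (1 : I) from Subtype.coe_le_coe.1 t.2.2)) hst
    have hyt_lt : yt < ystar := by
      by_contra h
      rw [not_lt] at h
      have := hfar yt h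
      rw [hct] at hnt
      linarith
    have hys_ge : ystar ≤ ys := by
      by_contra h
      rw [not_le] at h
      have := hbelow ys hys.le h
      rw [hcs] at hfs
      linarith
    have hlt := fallback_lt_of_lt hφ hg hcinj hc0 hc1 hcrange (Y := ys + 1) (by linarith) hst
      ⟨hys.le, by linarith⟩ ⟨hyt.le, by linarith⟩ hcs hct
    linarith
  · -- no far point at all on the geodesic
    refine ⟨1, zero_lt_one, fun c hcinj hc0 hc1 hcrange s t hst hfs _ => ?_⟩
    rcases fallback_value hφ hg hcinj hc0 hc1 hcrange s with ⟨hcsa, -⟩ | ⟨-, hs1⟩ | ⟨ys, hys, hcs⟩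
    · rw [hcsa, dist_self] at hfs
      linarith
    · rw [hs1] at hst
      exact (not_lt.2 (show t ≤ (1 : I) from Subtype.coe_le_coe.1 t.2.2)) hst
    · exact hKne ⟨ys, hys.le, by rw [← hcs]; exact hfs⟩

/-- **No escape along the fallback arc.** For every `ε > 0` there is `r > 0` (depending on
`(D, φ, ε)` only) such that no injective curve from `a` to `b` with trace `fallback a b Φ` is
`r`-close to `b` at a time `s` and `ε`-far from `b` at a later time `t`. -/
theorem fallback_no_escape {ε : ℝ} (hε : 0 < ε) :
    ∃ r > 0, ∀ (c : Curve ℂ), Injective c → c 0 = D.pt 0 → c 1 = D.pt 1 →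
      range c = fallback (D.pt 0) (D.pt 1) φ.boundaryExtension →
      ∀ s t : I, s < t → dist (c s) (D.pt 1) ≤ r → ε ≤ dist (c t) (D.pt 1) → False := by
  set g : ℝ → ℂ := fun y : ℝ => φ.boundaryExtension (Complex.I * (y : ℂ)) with hgdef
  have hg : ∀ y, g y = φ.boundaryExtension (Complex.I * (y : ℂ)) := fun y => rfl
  obtain ⟨hgc, hg0, hgb, hga, hginj, hglim⟩ := geodesic_spec hφ hg
  have hdc : ∀ p : ℂ, ContinuousOn (fun y => dist (g y) p) (Ici 0) := fun p =>
    continuous_dist.comp_continuousOn (hgc.prodMk continuousOn_const)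
  have hd : 0 < dist (D.pt 0) (D.pt 1) := dist_pos.2 (D.pt_injective.ne (by decide))
  set K : Set ℝ := {y | 0 ≤ y ∧ ε ≤ dist (g y) (D.pt 1)} with hK
  by_cases hKne : K.Nonempty
  · have hKcl : IsClosed K := by
      have : K = Ici 0 ∩ (fun y => dist (g y) (D.pt 1)) ⁻¹' Ici ε := by
        ext y; simp [hK, mem_Ici]
      rw [this]
      exact (hdc _).preimage_isClosed_of_isClosed isClosed_Ici isClosed_Ici
    -- `K` is bounded: far out the geodesic is `ε`-close to `b`
    obtain ⟨Y₀, hY₀⟩ : ∃ Y₀, ∀ y, Y₀ ≤ y → dist (g y) (D.pt 1) < ε := by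
      obtain ⟨Y₀, hY₀⟩ := Filter.eventually_atTop.1 (Metric.tendsto_nhds.1 hglim _ hε)
      exact ⟨Y₀, hY₀⟩
    have hKbdd : BddAbove K := ⟨Y₀, fun y hy => by
      by_contra h
      rw [not_le] at h
      have := hY₀ y h.le
      linarith [hy.2]⟩
    set ystar := sSup K with hystar
    have hymem : ystar ∈ K := hKcl.csSup_mem hKne hKbdd
    have habove : ∀ y, ystar < y → dist (g y) (D.pt 1) < ε := by
      intro y hlt
      by_contra h
      rw [not_lt] at h
      have : y ≤ ystar := le_csSup hKbdd ⟨hymem.1.trans hlt.le, h⟩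
      linarith
    -- on `[0, y*]` the geodesic stays at distance `≥ m > 0` from `b`
    obtain ⟨m, hm, hnear⟩ : ∃ m > 0, ∀ y, 0 ≤ y → y ≤ ystar → m ≤ dist (g y) (D.pt 1) := by
      have hcont : ContinuousOn (fun y => dist (g y) (D.pt 1)) (Icc 0 ystar) :=
        (hdc _).mono Icc_subset_Ici_self
      obtain ⟨y₀, hy₀, hmin⟩ := isCompact_Icc.exists_isMinOn (nonempty_Icc.2 hymem.1) hcont
      exact ⟨dist (g y₀) (D.pt 1), dist_pos.2 (hgb y₀ hy₀.1), fun y hy hy' => hmin ⟨hy, hy'⟩⟩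
    refine ⟨min m (dist (D.pt 0) (D.pt 1)) / 2, by positivity, ?_⟩
    intro c hcinj hc0 hc1 hcrange s t hst hns hft
    have hr_lt_m : min m (dist (D.pt 0) (D.pt 1)) / 2 < m := by
      have := min_le_left m (dist (D.pt 0) (D.pt 1)); linarith
    have hr_lt_d : min m (dist (D.pt 0) (D.pt 1)) / 2 < dist (D.pt 0) (D.pt 1) := by
      have := min_le_right m (dist (D.pt 0) (D.pt 1)); linarith
    rcases fallback_value hφ hg hcinj hc0 hc1 hcrange s with ⟨hcsa, -⟩ | ⟨-, hs1⟩ | ⟨ys, hys, hcs⟩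
    · rw [hcsa] at hns
      linarith
    · rw [hs1] at hst
      exact (not_lt.2 (show t ≤ (1 : I) from Subtype.coe_le_coe.1 t.2.2)) hst
    rcases fallback_value hφ hg hcinj hc0 hc1 hcrange t with ⟨-, ht0⟩ | ⟨hctb, -⟩ | ⟨yt, hyt, hct⟩
    · rw [ht0] at hst
      exact (not_lt.2 (show (0 : I) ≤ s from Subtype.coe_le_coe.1 s.2.1)) hst
    · rw [hctb, dist_self] at hft
      linarith
    have hys_gt : ystar < ys := by
      by_contra h
      rw [not_lt] at h
      have := hnear ys hys.le h
      rw [hcs] at hns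
      linarith
    have hyt_le : yt ≤ ystar := by
      by_contra h
      rw [not_le] at h
      have := habove yt h
      rw [hct] at hft
      linarith
    have hlt := fallback_lt_of_lt hφ hg hcinj hc0 hc1 hcrange (Y := ys + 1) (by linarith) hst
      ⟨hys.le, by linarith⟩ ⟨hyt.le, by linarith [hymem.1]⟩ hcs hct
    linarith
  · refine ⟨1, zero_lt_one, fun c hcinj hc0 hc1 hcrange s t hst _ hft => ?_⟩
    rcases fallback_value hφ hg hcinj hc0 hc1 hcrange t with ⟨-, ht0⟩ | ⟨hctb, -⟩ | ⟨yt, hyt, hct⟩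
    · rw [ht0] at hst
      exact (not_lt.2 (show (0 : I) ≤ s from Subtype.coe_le_coe.1 s.2.1)) hst
    · rw [hctb, dist_self] at hft
      linarith
    · exact hKne ⟨yt, hyt.le, by rw [← hct]; exact hft⟩

end Fallback

end AttachNoReturn

end Summit.CriticalPhenomena.SAWScalingLimit.Theorems
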